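import Summits.RiemannHypothesis.RiemannHypothesis.Theorems.SuzukiThetaFlowOutputsCoercive

/-!
# SuzukiThetaFlowDecay — the θ-FLOW DECAY LAW `ThetaFlowDecay` PROVED (column DBR; RH-FREE)

LINE 1 — LABEL: RH-FREE theorem (the PROOF-OF-DATA rung leaf of LADDER-RH column 6 DBR, theory round 2,
`Theorems.SuzukiThetaFlow.ThetaFlowDecay`, is discharged; no sign of `ε(t)` is asserted); bears_on: B-P(P2-flow)
(provisional id, fallback B-P(P2)).  WHAT THIS IS NOT: not a positivity statement, not a statement about zeros of `ζ`,
not evidence for or against RH.  Its clean-window / antitone consequences are unconditional exactly on the windows where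
Weil positivity is a TREE theorem (today `t ≤ 1`, `WeilFormatCData.A1.weilPositivityOn_one`); at the `∀ t` level they
are Weil's criterion re-indexed (RH-EQUIVALENT, declared by the card `theta-flow-weil-window`, NOT claimed); nothing here
is progress toward RH.

THE LAW (now a theorem, `thetaFlowDecay`).  For every `t > 0`, `1 < θ₀ ≤ θ₁`, `f ∈ L²(−t,t)`:

  `‖𝖪_{θ₁}[t] f‖² ≤ exp(−2·ε(t)·(θ₁ − θ₀)) · ‖𝖪_{θ₀}[t] f‖²`,

`𝖪_θ[t] = winOp (limKernel θ) t` ([Su20] (1.4)), `ε(t) = weilGroundEnergy t` (Bombieri 2000 §4).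

PROOF = the route `ThetaFlowDecay` of rh-dbr-theory g10 (HOME/rh-dbr-theory/round2/Sketch.lean), both cruxes being
tree theorems: K1 `FlowPairingAll` is [rh-dbr-eng] g6's `SuzukiThetaFlow.flowPairing` (hence (T0)
`SuzukiThetaFlow.thetaFlowIdentity : d/dθ ‖𝖪_θ[t]f‖² = −2 Re Q(g_θ)`), K2 `OutputsCoercive` is
`SuzukiThetaFlow.outputsCoercive` (`Theorems.SuzukiThetaFlowOutputsCoercive`, mollification), and the assembly is
theory g10's kernel-checked Grönwall step `decay_of_flow_coercive` (copied here VERBATIM with attribution: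
`θ ↦ e^{2ε(t)θ}‖𝖪_θ[t]f‖²` has derivative `2e^{2εθ}(ε‖𝖪_θ f‖² − Re Q(g_θ)) ≤ 0` on `(1,∞)`, `antitoneOn_of_deriv_nonpos`).

COROLLARIES (all RH-FREE): `weilWindowAntitone : WeilWindowAntitone` (idea-2's (T1) transfer W-C ⇒ B-P, as an
implication from `WeilPositivityOn t`); **`normSqAntitone_of_le_one`: `NormSqAntitone t` for every `0 < t ≤ 1`
UNCONDITIONALLY** (the first Column 2 ⇒ Column 6 theorem: on Column 2's certified window Suzuki's window norms
`‖𝖪_θ[t]f‖` are non-increasing in `θ > 1`); `opNormSqLe_of_le`: quadratic-form bounds propagate UP in `θ` with the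
factor `exp(−2ε(t)Δθ)`; `anchor_mono` / `uniformCleanWindow_of_anchor`: on windows `T ≤ 1` an anchor at `θ₀` is an
anchor at every `θ₁ ≥ θ₀` and gives the θ-UNIFORM clean window `∀ θ ≥ θ₀, CleanUpTo θ T`; in particular
`rungTwelveOne_of_anchor : Anchor 12 1 → RungTwelveOne` (the card's rung now rests on the ONE kit-certified anchor
ET1b, `‖𝖪₁₂[t]‖² ≤ 0.9965 < 1` for `t ≤ 1`, two interval lineages — not a Lean theorem).

References: [Su20] M. Suzuki, ASPM 84 (2020) = arXiv:1907.07302, (1.4); A. Weil (1952); E. Bombieri, Rend. Lincei (9) 11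
(2000) §4; M. Suzuki, arXiv:2606.09096 (2026) Thm 1.3.
-/

noncomputable section

-- D-0017: `Summit.<S>.<S>.…` is the designed namespace of a single-problem summit.
set_option linter.dupNamespace false

open Complex MeasureTheory Set

namespace Summit.RiemannHypothesis.RiemannHypothesis.Theorems.SuzukiThetaFlow

open Literature.NumberTheory.LFunctions
open Summit.RiemannHypothesis.RiemannHypothesis.Theorems.SuzukiCleanRadius (CleanUpTo)

/-! ## §1 Grönwall (theory g10's assembly, verbatim) and the law -/

/-- RH-FREE · **the Grönwall step** (rh-dbr-theory g10, HOME/rh-dbr-theory/round2/Sketch.lean `decay_of_flow_coercive`,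
kernel-checked there; copied verbatim): (T0) on the window + coercivity of `ε(t)` on the outputs ⇒ the decay law on
that window. -/
theorem decay_of_flow_coercive {t : ℝ} (hT0 : ThetaFlowIdentity t)
    (hco : ∀ θ : ℝ, 1 < θ → ∀ f : ℝ → ℝ, MemLp f 2 (winMeasure t) →
      weilGroundEnergy t * winNormSq (limKernel θ) t f ≤ (weilQuadratic (winOut θ t f)).re)
    {θ₀ θ₁ : ℝ} (hθ₀ : 1 < θ₀) (hθ₀₁ : θ₀ ≤ θ₁) {f : ℝ → ℝ} (hf : MemLp f 2 (winMeasure t)) :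
    winNormSq (limKernel θ₁) t f ≤
      Real.exp (-2 * weilGroundEnergy t * (θ₁ - θ₀)) * winNormSq (limKernel θ₀) t f := by
  set ε : ℝ := weilGroundEnergy t with hε
  set N : ℝ → ℝ := fun θ' => winNormSq (limKernel θ') t f with hN
  set F : ℝ → ℝ := fun θ' => Real.exp (2 * ε * θ') * N θ' with hF
  have hderivN : ∀ θ ∈ Ioi (1 : ℝ), HasDerivAt N (-2 * (weilQuadratic (winOut θ t f)).re) θ :=
    fun θ hθ => hT0 θ hθ f hf
  have hderivE : ∀ θ : ℝ, HasDerivAt (fun θ' : ℝ => Real.exp (2 * ε * θ')) (Real.exp (2 * ε * θ) * (2 * ε)) θ := by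
    intro θ
    have h := ((hasDerivAt_id θ).const_mul (2 * ε)).exp
    simpa using h
  have hderivF : ∀ θ ∈ Ioi (1 : ℝ), HasDerivAt F
      (Real.exp (2 * ε * θ) * (2 * ε) * N θ + Real.exp (2 * ε * θ) * (-2 * (weilQuadratic (winOut θ t f)).re)) θ :=
    fun θ hθ => (hderivE θ).mul (hderivN θ hθ)
  have hdiff : DifferentiableOn ℝ F (interior (Ioi (1 : ℝ))) := by
    rw [interior_Ioi]
    exact fun θ hθ => (hderivF θ hθ).differentiableAt.differentiableWithinAt
  have hcont : ContinuousOn F (Ioi (1 : ℝ)) :=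
    fun θ hθ => (hderivF θ hθ).differentiableAt.continuousAt.continuousWithinAt
  have hnonpos : ∀ θ ∈ interior (Ioi (1 : ℝ)), deriv F θ ≤ 0 := by
    rw [interior_Ioi]
    intro θ hθ
    rw [(hderivF θ hθ).deriv]
    have hc : ε * N θ ≤ (weilQuadratic (winOut θ t f)).re := hco θ hθ f hf
    have hpos : 0 < Real.exp (2 * ε * θ) := Real.exp_pos _
    have hrw : Real.exp (2 * ε * θ) * (2 * ε) * N θ +
        Real.exp (2 * ε * θ) * (-2 * (weilQuadratic (winOut θ t f)).re) =
        2 * Real.exp (2 * ε * θ) * (ε * N θ - (weilQuadratic (winOut θ t f)).re) := by ring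
    rw [hrw]
    have hle : ε * N θ - (weilQuadratic (winOut θ t f)).re ≤ 0 := sub_nonpos.2 hc
    nlinarith
  have hanti := antitoneOn_of_deriv_nonpos (convex_Ioi (1 : ℝ)) hcont hdiff hnonpos
  have hFle : F θ₁ ≤ F θ₀ := hanti (mem_Ioi.2 hθ₀) (mem_Ioi.2 (lt_of_lt_of_le hθ₀ hθ₀₁)) hθ₀₁
  -- unfold: exp(2εθ₁) N θ₁ ≤ exp(2εθ₀) N θ₀
  have hFle' : Real.exp (2 * ε * θ₁) * N θ₁ ≤ Real.exp (2 * ε * θ₀) * N θ₀ := hFle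
  have hexp : Real.exp (-2 * ε * (θ₁ - θ₀)) = Real.exp (2 * ε * θ₀) / Real.exp (2 * ε * θ₁) := by
    rw [← Real.exp_sub]
    congr 1
    ring
  show N θ₁ ≤ Real.exp (-2 * ε * (θ₁ - θ₀)) * N θ₀
  rw [hexp, div_mul_eq_mul_div, le_div_iff₀ (Real.exp_pos _), mul_comm]
  exact hFle'

/-- **RH-FREE · THE θ-FLOW DECAY LAW, PROVED** (`ThetaFlowDecay`, the round-2 rung leaf of column DBR): for every window
`t > 0`, every `1 < θ₀ ≤ θ₁` and every `f ∈ L²(−t,t)`,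
`‖𝖪_{θ₁}[t]f‖² ≤ exp(−2 ε(t) (θ₁ − θ₀)) ‖𝖪_{θ₀}[t]f‖²`.  (T0) = `thetaFlowIdentity` (from `flowPairing`),
coercivity = `outputsCoercive`, Grönwall = `decay_of_flow_coercive`.  No sign of `ε(t)` is asserted; nothing here bears
on RH. -/
theorem thetaFlowDecay : ThetaFlowDecay :=
  fun t ht _ _ hθ₀ hθ₀₁ _ hf =>
    decay_of_flow_coercive (thetaFlowIdentity t) (outputsCoercive t ht) hθ₀ hθ₀₁ hf

/-! ## §2 Corollaries: (T1), the unconditional Column 2 ⇒ Column 6 window, anchors propagate in θ -/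

/-- **RH-FREE · (T1) `WeilWindowAntitone` PROVED** (idea-2's transfer W-C ⇒ B-P as an implication): Weil positivity on
the window of half-width `t` makes Suzuki's window norms θ-antitone on that window.  The hypothesis
`WeilPositivityOn t` is a tree theorem for `t ≤ 1` and RH-EQUIVALENT for all `t`; nothing here bears on RH. -/
theorem weilWindowAntitone : WeilWindowAntitone := weilWindowAntitone_of_decay thetaFlowDecay

/-- **RH-FREE · UNCONDITIONAL (T1) ON COLUMN 2's CERTIFIED WINDOW**: for every `0 < t ≤ 1`, every `1 < θ₀ ≤ θ₁` and
every `f ∈ L²(−t,t)`, `‖𝖪_{θ₁}[t]f‖² ≤ ‖𝖪_{θ₀}[t]f‖²` — the Weil input being the TREE theorem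
`WeilFormatCData.A1.weilPositivityOn_one`.  A finite-window fact about one explicit operator family; not evidence for
RH. -/
theorem normSqAntitone_of_le_one {t : ℝ} (ht : 0 < t) (ht1 : t ≤ 1) : NormSqAntitone t :=
  normSqAntitone_of_decay_le_one thetaFlowDecay ht ht1

/-- RH-FREE · **quadratic-form bounds propagate UP in θ with the decay factor**: `‖𝖪_{θ₀}[t]f‖² ≤ q‖f‖²` for all `f`
gives `‖𝖪_{θ₁}[t]f‖² ≤ e^{−2ε(t)(θ₁−θ₀)} q ‖f‖²` for `θ₁ ≥ θ₀ > 1` (`t > 0`).  Nothing here bears on RH. -/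
theorem opNormSqLe_of_le {θ₀ θ₁ t q : ℝ} (ht : 0 < t) (hθ₀ : 1 < θ₀) (hθ₀₁ : θ₀ ≤ θ₁) (hq : OpNormSqLe θ₀ t q) :
    OpNormSqLe θ₁ t (Real.exp (-2 * weilGroundEnergy t * (θ₁ - θ₀)) * q) := by
  intro f hf
  calc winNormSq (limKernel θ₁) t f
      ≤ Real.exp (-2 * weilGroundEnergy t * (θ₁ - θ₀)) * winNormSq (limKernel θ₀) t f :=
        thetaFlowDecay t ht θ₀ θ₁ hθ₀ hθ₀₁ f hf
    _ ≤ Real.exp (-2 * weilGroundEnergy t * (θ₁ - θ₀)) * (q * l2NormSq t f) :=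
        mul_le_mul_of_nonneg_left (hq f hf) (Real.exp_pos _).le
    _ = Real.exp (-2 * weilGroundEnergy t * (θ₁ - θ₀)) * q * l2NormSq t f := by ring

/-- RH-FREE · on a Weil-positive window a quadratic-form bound at `θ₀` holds at every `θ₁ ≥ θ₀`
(`WeilPositivityOn t ⇒ ε(t) ≥ 0 ⇒` factor `≤ 1`).  Nothing here bears on RH. -/
theorem opNormSqLe_mono {θ₀ θ₁ t q : ℝ} (ht : 0 < t) (hW : WeilPositivityOn t) (hθ₀ : 1 < θ₀) (hθ₀₁ : θ₀ ≤ θ₁)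
    (hq : OpNormSqLe θ₀ t q) : OpNormSqLe θ₁ t q := fun f hf =>
  le_trans (normSqAntitone_of_decay thetaFlowDecay ht hW θ₀ θ₁ hθ₀ hθ₀₁ f hf) (hq f hf)

/-- RH-FREE · **anchors propagate up in θ on the certified Weil windows**: for `T ≤ 1`, an anchor
(`‖𝖪_{θ₀}[t]‖² ≤ q(t) < 1` on every sub-window `t ≤ T`) at `θ₀ > 1` is an anchor at every `θ₁ ≥ θ₀`
(`weilPositivityOn_one`).  Nothing here bears on RH. -/
theorem anchor_mono {θ₀ θ₁ T : ℝ} (hT : T ≤ 1) (hθ₀ : 1 < θ₀) (hθ₀₁ : θ₀ ≤ θ₁) (h : Anchor θ₀ T) :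
    Anchor θ₁ T := by
  intro t ht0 htT
  obtain ⟨q, hq, hle⟩ := h t ht0 htT
  refine ⟨q, hq, ?_⟩
  rcases ht0.eq_or_lt with h0 | hpos
  · subst h0
    intro f hf
    have h1 := hle f hf
    rw [winNormSq_zero_window] at h1 ⊢
    exact h1
  · exact opNormSqLe_mono hpos (WeilPositivityOn.mono (htT.trans hT)
      Summit.RiemannHypothesis.RiemannHypothesis.Theorems.WeilFormatCData.A1.weilPositivityOn_one) hθ₀ hθ₀₁ hle

/-- **RH-FREE · θ-UNIFORM CLEAN WINDOWS FROM ONE ANCHOR** (generalises the card's `rung_of'` from `(12, 1)` to any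
`θ₀ > 1`, `T ≤ 1`): an anchor at `θ₀` on `[0,T]` makes every window `t ≤ T` of `𝖪_θ` free of the eigenvalues `±1`
for EVERY `θ ≥ θ₀` (`(T1)` unconditional on `t ≤ 1` + `contractionExcludes`).  Each instance is a finite fact about
explicit operators; the `∀ T` level is RH-EQUIVALENT; nothing here bears on RH. -/
theorem uniformCleanWindow_of_anchor {θ₀ T : ℝ} (hT : T ≤ 1) (hθ₀ : 1 < θ₀) (h : Anchor θ₀ T) :
    UniformCleanWindow θ₀ T := by
  refine uniformCleanWindow_of_antitone_anchor hθ₀ (fun t ht0 htT => ?_) h contractionExcludes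
  rcases ht0.eq_or_lt with h0 | hpos
  · subst h0
    intro _ _ _ _ _ _
    rw [winNormSq_zero_window, winNormSq_zero_window]
  · exact normSqAntitone_of_le_one hpos (htT.trans hT)

/-- **RH-FREE · THE CARD's RUNG NOW RESTS ON ONE NUMBER**: `Anchor 12 1 → RungTwelveOne` (`∀ θ ≥ 12`, every window
`t ≤ 1` of `𝖪_θ` is free of `±1`).  The anchor `‖𝖪₁₂[t]‖² < 1 ∀ t ≤ 1` is kit-certified (DATA §ET1b: two interval
lineages, `1 − ‖𝖪₁₂[1]‖ ∈ [3.5758e-3, 3.5759e-3]`) but NOT a Lean theorem; nothing here bears on RH. -/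
theorem rungTwelveOne_of_anchor (hanchor : Anchor 12 1) : RungTwelveOne :=
  rungTwelveOne_of_decay thetaFlowDecay hanchor

end Summit.RiemannHypothesis.RiemannHypothesis.Theorems.SuzukiThetaFlow

end
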